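import Summits.ResolutionOfSingularities.ResolutionOfSingularities.Theorems.EquisingularLiftEquisingularLiftNatDirDictAdaptedFrame
import HarnessLib

/-!
# [OURS · L1 W4.5(b) · EL♮(3)] DIRDICT (a) part 2 — THE CRITERION: a direction ADAPTED to a section curve `Γ` of the exceptional
# `ℙ¹`-bundle has `Γ̃` as its centre, `controlledTransform υ Ī 𝒟 1 = 𝓘⟨Γ⟩`

Crux chain w45b (cell `res-hironaka`, slot W4.5(b)), working crux **EL♮** = stmt-ResolutionOfSingularities-20038, child **EL♮(3)** =
stmt-ResolutionOfSingularities-20148, route EquisingularLift, line `sections`; registered stubs `stub_elnat_ratDirZeroPointResolution`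
(rung DIR₀₀) and `stub_elnat_ratTowerPointResolution` (TOWER₀, Čech-witnessed rounds); object **DIRDICT (a)** (res-L1-w45b-plan-1
RULING-6 / WORD (α) / NO OBJECTION 18:12:58Z; currency (α) CHARTWISE ROOTED = res-L1-w45b-stub-2's T-DIRLIFT ideal currency D1–D4).
Part 2 after part 1 (…NatDirDictAdaptedFrame, p555912). HONEST FRAMING: OURS; NOT a statement of any manuscript; AI-written, weaker
than expert review. No `sorry`; standard axioms. DEF-FREE. `--supports stmt-ResolutionOfSingularities-20148 --as helper`.

SETTING (root-local, downstairs). `υ : G₁ → G` a blowing up along an ideal sheaf `IZ` (the carrier curve), `IΓ` an ideal sheaf on `G₁`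
with `V(IΓ) ⊆ υ⁻¹V(IZ)` and an ISOMORPHISM `δ : V(IΓ) ⟶ V(IZ)` over `υ` (for the reduced structures on a section curve `Γ ⊆ υ⁻¹Z` of the
exceptional ruled surface this is `DirStepSec` read at the root), and a DIRECTION `𝒟` along `IZ` (`IZ·IZ ≤ 𝒟`) ADAPTED TO the section:
at every point `y` of `V(IΓ)` a quasi-regular frame `c = (ℓ, m)` of `(IZ)_{υ y}` with `𝒟_{υ y} = (ℓ) + (m²)`, a chart-`m` presentation
`(𝔔, χ)` of `𝒪_{G₁,y}` (T-PRES-CHART currency) and `χ(ℓ/m) ∈ (IΓ)_y` — exactly the output of part 1's `exists_sectionAdaptedFrame` at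
`P = (IΓ)_y`.

WHAT (namespace `…Cruxes.EquisingularLiftNat.Sections`).
* `le_of_surjective_of_ker_le` — two ideals `𝔞 ≤ P` of `S` receiving `R` ONTO `S/𝔞` with `ker(R → S/P) ≤ ker(R → S/𝔞)` are equal.
* `range_frac_ne_one`, `map_directionCentre_pair` — for a pair the direction-centre ideal `𝔞 = (m/1) + (ℓ/m)` of D3a maps to
  `(φ m) + (χ(ℓ/m))` under a chart presentation `χ` over `φ`.
* `mem_support_vanishingIdeal_iff`, `exists_mem_support_of_section` — support bookkeeping; the section is onto the carrier.
* `stalkIdeal_eq_span_sup_span_of_adapted` — at a point `y` of the section: **`(IΓ)_y = (υ♯ m) + (χ(ℓ/m))`** (both quotients of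
  `𝒪_{G₁,y}` receive `𝒪_{G,υ y}` onto with kernel `(IZ)_{υ y}`: part 1 `surjective_and_ker_mk_comp_stalkMap_of_section`, D3a
  `surjective_mk_map_directionCentre_comp` / `comap_map_directionCentre`).
* **`controlledTransform_eq_of_adapted`** (general `IΓ`, `IZ`) and **`controlledTransform_eq_vanishingIdeal_of_adapted`** (the reduced
  structures `𝓘⟨Γ⟩`, `𝓘⟨Z⟩`): `controlledTransform υ IZ 𝒟 1 = IΓ`. Stalkwise (`ext_of_forall_stalkIdeal_eq`): off `υ⁻¹V(IZ)` both are
  `⊤`; at a point of the section by the previous item and D1 `stalkIdeal_directionCentre_of_chart_one`; at `y ∈ υ⁻¹V(IZ)` off the section,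
  over `υ y₀` with `y₀` on the section: on the chart `ℓ` the centre is `⊤` (D1), on the chart `m` a point of the centre would have the prime
  of `y₀` (D3a `eq_of_directionCentre_le_of_comap_eq`), hence BE `y₀` (T-PTPRIME `eq_of_chartPresentation_of_prime_eq`).

References: The Stacks Project, Tags 0804, 052P; Görtz–Wedhorn I (13.19); BGMW 2011 §3.2 (controlled transform) — through the tree (D1 p547943,
D3a p552294, T-PTPRIME p521370/p540294, part 1 p555912, Literature `MarkedIdeals`/`MarkedIdealsLemmas`/`CoefficientIdealRestriction`).
-/

noncomputable section

open CategoryTheory AlgebraicGeometry TopologicalSpace IsLocalRing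
open Literature.AlgebraicGeometry.Resolution
open AlgebraicGeometry.Scheme.IdealSheafData

set_option linter.dupNamespace false -- mandated namespace `Summit.<Summit>.<Problem>` of this single-conjunct summit

namespace Summit.ResolutionOfSingularities.ResolutionOfSingularities.Cruxes.EquisingularLiftNat.Sections

universe u

/-! ## 1. Ring lemmas -/

section Ring

variable {R S : Type u} [CommRing R] [CommRing S]

/-- **Two quotients receiving `R` onto with comparable kernels.** If `𝔞 ≤ P` are ideals of `S`, `ψ : R → S`, `R → S/𝔞` is onto and
`ker(R → S/P) ≤ ker(R → S/𝔞)`, then `P ≤ 𝔞` (so `P = 𝔞`). [folklore] -/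
theorem le_of_surjective_of_ker_le (ψ : R →+* S) {𝔞 P : Ideal S} (h𝔞P : 𝔞 ≤ P)
    (hsurj : Function.Surjective ((Ideal.Quotient.mk 𝔞).comp ψ))
    (hker : RingHom.ker ((Ideal.Quotient.mk P).comp ψ) ≤ RingHom.ker ((Ideal.Quotient.mk 𝔞).comp ψ)) : P ≤ 𝔞 := by
  intro s hs
  obtain ⟨r, hr⟩ := hsurj (Ideal.Quotient.mk 𝔞 s)
  rw [RingHom.comp_apply, Ideal.Quotient.eq] at hr
  -- `ψ r - s ∈ 𝔞 ⊆ P`, so `ψ r ∈ P`, so `r ∈ ker (R → S/P) ⊆ ker (R → S/𝔞)`, so `ψ r ∈ 𝔞`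
  have hψr : ψ r ∈ P := by
    have h := P.add_mem (h𝔞P hr) hs
    rwa [sub_add_cancel] at h
  have hr𝔞 : ψ r ∈ 𝔞 := by
    have h : r ∈ RingHom.ker ((Ideal.Quotient.mk P).comp ψ) := by
      rw [RingHom.mem_ker, RingHom.comp_apply, Ideal.Quotient.eq_zero_iff_mem]; exact hψr
    have h' := hker h
    rwa [RingHom.mem_ker, RingHom.comp_apply, Ideal.Quotient.eq_zero_iff_mem] at h'
  have h : s = ψ r - (ψ r - s) := by ring
  rw [h]
  exact 𝔞.sub_mem hr𝔞 hr

/-- **Abstract form used at the stalk**: with `A → B → S` (`χ = algebraMap B S` over `φ : A → S`), an ideal `𝔞` of `B` with `𝔞S ≤ P`,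
`A → S/𝔞S` onto, `𝔞S ∩ A = I` and `ker(A → S/P) = I`: `P = 𝔞S`. [folklore] -/
theorem eq_map_of_surjective_of_comap_eq {A B S' : Type u} [CommRing A] [CommRing B] [CommRing S'] [Algebra A B] [Algebra B S']
    (φ : A →+* S') (hφ : ∀ a, algebraMap B S' (algebraMap A B a) = φ a) (𝔞 : Ideal B) {P : Ideal S'} {I : Ideal A}
    (h𝔞P : 𝔞.map (algebraMap B S') ≤ P)
    (hsurj : Function.Surjective ((Ideal.Quotient.mk (𝔞.map (algebraMap B S'))).comp ((algebraMap B S').comp (algebraMap A B))))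
    (hcomap : (𝔞.map (algebraMap B S')).comap ((algebraMap B S').comp (algebraMap A B)) = I)
    (hkerP : RingHom.ker ((Ideal.Quotient.mk P).comp φ) = I) :
    P = 𝔞.map (algebraMap B S') := by
  have hcomp : (algebraMap B S').comp (algebraMap A B) = φ := RingHom.ext hφ
  rw [hcomp] at hsurj hcomap
  refine le_antisymm (le_of_surjective_of_ker_le φ h𝔞P hsurj ?_) h𝔞P
  rw [hkerP, ← hcomap]
  intro r hr
  rw [RingHom.mem_ker, RingHom.comp_apply, Ideal.Quotient.eq_zero_iff_mem]
  exact hr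

/-- For a pair, the only index `≠ 1` is `0`. [folklore] -/
theorem range_frac_ne_one {β : Type*} (f : Fin 2 → β) : Set.range (fun j : {j : Fin 2 // j ≠ 1} => f j.1) = {f 0} := by
  ext b
  constructor
  · rintro ⟨⟨j, hj⟩, rfl⟩
    have hj0 : j = 0 := by
      rcases Fin.exists_fin_two.mp ⟨j, rfl⟩ with h | h
      · exact h
      · exact absurd h hj
    subst hj0
    rfl
  · rintro rfl
    exact ⟨⟨0, by decide⟩, rfl⟩

/-- **The direction-centre ideal of the chart `m` under a presentation.** For a pair `c = (ℓ, m)` and a ring map `χ : R[I/m] → S` over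
`φ`, D3a's ideal `𝔞 = (m/1) + (ℓ/m)` maps to `(φ m) + (χ(ℓ/m))`. [folklore] -/
theorem map_directionCentre_pair (φ : R →+* S) (c : Fin 2 → R)
    (χ : blowupAlgebra (Ideal.span (Set.range c)) (c 1) →+* S) (hχ : ∀ a, χ (algebraMap _ _ a) = φ a) :
    (Ideal.span {algebraMap R (blowupAlgebra (Ideal.span (Set.range c)) (c 1)) (c 1)} ⊔
        Ideal.span (Set.range fun j : {j : Fin 2 // j ≠ 1} => blowupAlgebra.frac c 1 j.1)).map χ =
      Ideal.span {φ (c 1)} ⊔ Ideal.span {χ (blowupAlgebra.frac c 1 0)} := by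
  rw [range_frac_ne_one (fun j => blowupAlgebra.frac c 1 j), Ideal.map_sup, Ideal.map_span, Ideal.map_span,
    Set.image_singleton, Set.image_singleton, hχ]

/-- The direction-centre ideal of a pair lies in a prime `𝔔` of the chart presented by `χ` iff both generators map into `𝔪_S`. [folklore] -/
theorem directionCentre_pair_le_chartPrime {S' : Type u} [CommRing S'] [IsLocalRing S'] (c : Fin 2 → R)
    (𝔔 : PrimeSpectrum (blowupAlgebra (Ideal.span (Set.range c)) (c 1)))
    (χ : blowupAlgebra (Ideal.span (Set.range c)) (c 1) →+* S')
    (hloc : @IsLocalization.AtPrime _ _ S' _ χ.toAlgebra 𝔔.asIdeal _)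
    (hm : χ (algebraMap _ _ (c 1)) ∈ maximalIdeal S') (hf : χ (blowupAlgebra.frac c 1 0) ∈ maximalIdeal S') :
    Ideal.span {algebraMap R (blowupAlgebra (Ideal.span (Set.range c)) (c 1)) (c 1)} ⊔
        Ideal.span (Set.range fun j : {j : Fin 2 // j ≠ 1} => blowupAlgebra.frac c 1 j.1) ≤ 𝔔.asIdeal := by
  rw [range_frac_ne_one (fun j => blowupAlgebra.frac c 1 j)]
  refine sup_le ?_ ?_
  · rw [Ideal.span_singleton_le_iff_mem, mem_chartPrime_iff_apply_mem_maximalIdeal 𝔔 χ hloc]; exact hm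
  · rw [Ideal.span_singleton_le_iff_mem, mem_chartPrime_iff_apply_mem_maximalIdeal 𝔔 χ hloc]; exact hf

end Ring

/-! ## 2. Supports; the section hits every point of the carrier -/

section Section

variable {G₁ G : Scheme.{u}} {υ : G₁ ⟶ G}

/-- Membership in the support of a vanishing ideal sheaf. [folklore] -/
theorem mem_support_vanishingIdeal_iff {X : Scheme.{u}} (Z : Set X) (hZ : IsClosed Z) (x : X) :
    x ∈ (vanishingIdeal (⟨Z, hZ⟩ : Closeds X)).support ↔ x ∈ Z := by
  rw [← SetLike.mem_coe, coe_support_vanishingIdeal]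
  rfl

/-- Membership in the range of `V(I) → X`. [folklore] -/
theorem mem_range_subschemeι_iff {X : Scheme.{u}} (I : X.IdealSheafData) (x : X) :
    x ∈ Set.range I.subschemeι ↔ x ∈ I.support := by
  rw [range_subschemeι]
  rfl

/-- Evaluating `δ ≫ inv δ` at a point. [folklore] -/
theorem inv_apply_apply {X Y : Scheme.{u}} (δ : X ⟶ Y) [IsIso δ] (x : X) : (inv δ) (δ x) = x := by
  rw [← Scheme.Hom.comp_apply, IsIso.hom_inv_id]
  rfl

/-- Evaluating `inv δ ≫ δ` at a point. [folklore] -/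
theorem apply_inv_apply {X Y : Scheme.{u}} (δ : X ⟶ Y) [IsIso δ] (y : Y) : δ ((inv δ) y) = y := by
  rw [← Scheme.Hom.comp_apply, IsIso.inv_hom_id]
  rfl

/-- **The section is onto**: for an isomorphism `δ : V(IΓ) ⟶ V(IZ)` over `υ`, every point of `V(IZ)`'s support is `υ y₀` for some `y₀`
on `V(IΓ)`. [folklore] -/
theorem exists_mem_support_of_section {IΓ : G₁.IdealSheafData} {IZ : G.IdealSheafData}
    (δ : IΓ.subscheme ⟶ IZ.subscheme) [IsIso δ] (hδ : δ ≫ IZ.subschemeι = IΓ.subschemeι ≫ υ)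
    {z : G} (hz : z ∈ IZ.support) : ∃ y₀' : ↥IΓ.subscheme, υ (IΓ.subschemeι y₀') = z := by
  obtain ⟨z', rfl⟩ := (mem_range_subschemeι_iff IZ z).mpr hz
  refine ⟨(inv δ) z', ?_⟩
  rw [← Scheme.Hom.comp_apply, ← hδ, Scheme.Hom.comp_apply, apply_inv_apply]

end Section

/-! ## 3. The stalk of `IΓ` at a point of the section in an adapted frame -/

section Adapted

variable {G₁ G : Scheme.{u}} {υ : G₁ ⟶ G}

/-- **`(IΓ)_y = (υ♯ m) + (χ(ℓ/m))` in an adapted frame.** `δ : V(IΓ) ≅ V(IZ)` over `υ` (a section), `y = ι_Γ y'`, `c = (ℓ, m)` a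
quasi-regular frame of `(IZ)_{υ y}` with a chart-`m` presentation `(𝔔, χ)` of `𝒪_{G₁,y}` and `χ(ℓ/m) ∈ (IΓ)_y`. Then
`(IΓ)_y = (υ♯ m) + (χ(ℓ/m))`. [cite: StacksProject, Tag 052P] -/
theorem stalkIdeal_eq_span_sup_span_of_adapted {IΓ : G₁.IdealSheafData} {IZ : G.IdealSheafData}
    (δ : IΓ.subscheme ⟶ IZ.subscheme) [IsIso δ] (hδ : δ ≫ IZ.subschemeι = IΓ.subschemeι ≫ υ) (y' : ↥IΓ.subscheme)
    (c : Fin 2 → G.presheaf.stalk (υ (IΓ.subschemeι y')))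
    (hc : Ideal.span (Set.range c) = stalkIdeal IZ (υ (IΓ.subschemeι y'))) (hqr : IsQuasiRegular c)
    (𝔔 : PrimeSpectrum (blowupAlgebra (Ideal.span (Set.range c)) (c 1)))
    (χ : blowupAlgebra (Ideal.span (Set.range c)) (c 1) →+* G₁.presheaf.stalk (IΓ.subschemeι y'))
    (hχ : ∀ a, χ (algebraMap _ _ a) = (υ.stalkMap (IΓ.subschemeι y')).hom a)
    (hloc : @IsLocalization.AtPrime _ _ (G₁.presheaf.stalk (IΓ.subschemeι y')) _ χ.toAlgebra 𝔔.asIdeal _)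
    (h𝔔 : 𝔔.asIdeal.comap (algebraMap _ (blowupAlgebra (Ideal.span (Set.range c)) (c 1))) =
      maximalIdeal (G.presheaf.stalk (υ (IΓ.subschemeι y'))))
    (hfrac : χ (blowupAlgebra.frac c 1 0) ∈ stalkIdeal IΓ (IΓ.subschemeι y')) :
    stalkIdeal IΓ (IΓ.subschemeι y') =
      Ideal.span {(υ.stalkMap (IΓ.subschemeι y')).hom (c 1)} ⊔ Ideal.span {χ (blowupAlgebra.frac c 1 0)} := by
  obtain ⟨hsurjP, hkerP⟩ := surjective_and_ker_mk_comp_stalkMap_of_section δ hδ y'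
  letI alg := χ.toAlgebra
  haveI : IsLocalization.AtPrime (G₁.presheaf.stalk (IΓ.subschemeι y')) 𝔔.asIdeal := hloc
  -- from now on `χ` is spelled `algebraMap B S`
  have hχA : ∀ a, algebraMap (blowupAlgebra (Ideal.span (Set.range c)) (c 1)) (G₁.presheaf.stalk (IΓ.subschemeι y'))
      (algebraMap _ (blowupAlgebra (Ideal.span (Set.range c)) (c 1)) a) = (υ.stalkMap (IΓ.subschemeι y')).hom a := hχ
  have hfracA : algebraMap (blowupAlgebra (Ideal.span (Set.range c)) (c 1)) (G₁.presheaf.stalk (IΓ.subschemeι y'))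
      (blowupAlgebra.frac c 1 0) ∈ stalkIdeal IΓ (IΓ.subschemeι y') := hfrac
  -- the image `𝔞S = (φ m) + (χ(ℓ/m))` of the direction-centre ideal of the chart
  have h𝔞S := map_directionCentre_pair (υ.stalkMap (IΓ.subschemeι y')).hom c
    (algebraMap (blowupAlgebra (Ideal.span (Set.range c)) (c 1)) (G₁.presheaf.stalk (IΓ.subschemeι y'))) hχA
  -- `𝔞S ≤ P`: `φ m ∈ P` since `m ∈ (IZ)_z = ker (R → S/P)`, and `χ(ℓ/m) ∈ P` by adaptedness
  have hm : (υ.stalkMap (IΓ.subschemeι y')).hom (c 1) ∈ stalkIdeal IΓ (IΓ.subschemeι y') := by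
    have h : c 1 ∈ RingHom.ker ((Ideal.Quotient.mk (stalkIdeal IΓ (IΓ.subschemeι y'))).comp
        (υ.stalkMap (IΓ.subschemeι y')).hom) := by
      rw [hkerP, ← hc]; exact Ideal.subset_span (Set.mem_range_self 1)
    rwa [RingHom.mem_ker, RingHom.comp_apply, Ideal.Quotient.eq_zero_iff_mem] at h
  have h𝔞P : (Ideal.span {algebraMap _ (blowupAlgebra (Ideal.span (Set.range c)) (c 1)) (c 1)} ⊔
      Ideal.span (Set.range fun j : {j : Fin 2 // j ≠ 1} => blowupAlgebra.frac c 1 j.1)).map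
      (algebraMap (blowupAlgebra (Ideal.span (Set.range c)) (c 1)) (G₁.presheaf.stalk (IΓ.subschemeι y'))) ≤
      stalkIdeal IΓ (IΓ.subschemeι y') := by
    rw [h𝔞S]
    exact sup_le (by rw [Ideal.span_singleton_le_iff_mem]; exact hm) (by rw [Ideal.span_singleton_le_iff_mem]; exact hfracA)
  -- `𝔞 ≤ 𝔔` (both generators land in `𝔪_y` under `χ`)
  have hPmax : stalkIdeal IΓ (IΓ.subschemeι y') ≤ maximalIdeal _ :=
    (mem_support_iff_stalkIdeal_le IΓ _).mp (subschemeι_apply_mem_support IΓ y')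
  have h𝔞𝔔 := directionCentre_pair_le_chartPrime c 𝔔 χ hloc (by rw [hχ]; exact hPmax hm) (hPmax hfrac)
  -- D3a: `R → S/𝔞S` onto with kernel `(c) = (IZ)_z`; conclude `P = 𝔞S` in the abstract form
  have hsurjD := surjective_mk_map_directionCentre_comp (S := G₁.presheaf.stalk (IΓ.subschemeι y')) c 1 𝔔.asIdeal h𝔞𝔔 h𝔔
  have hkerD := comap_map_directionCentre (S := G₁.presheaf.stalk (IΓ.subschemeι y')) c 1 hqr 𝔔.asIdeal h𝔞𝔔 h𝔔
  have hP := eq_map_of_surjective_of_comap_eq (υ.stalkMap (IΓ.subschemeι y')).hom hχA _ h𝔞P hsurjD hkerD (hkerP.trans hc.symm)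
  rw [hP, h𝔞S]
  rfl

end Adapted

/-! ## 4. The criterion -/

section Criterion

variable {G₁ G : Scheme.{u}} {υ : G₁ ⟶ G}

/-- **A direction ADAPTED to a section has the section as its centre** (general ideal sheaves). `υ : G₁ → G` a blowing up along `IZ`,
`IΓ` on `G₁` with `V(IΓ) ⊆ υ⁻¹V(IZ)` and an isomorphism `δ : V(IΓ) ⟶ V(IZ)` over `υ`, `𝒟` with `IZ·IZ ≤ 𝒟` admitting at every point `y` of
`V(IΓ)` a quasi-regular frame `c = (ℓ, m)` of `(IZ)_{υ y}` with `𝒟_{υ y} = (ℓ) + (m²)` and a chart-`m` presentation `(𝔔, χ)` of `𝒪_{G₁,y}`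
with `χ(ℓ/m) ∈ (IΓ)_y`. Then `controlledTransform υ IZ 𝒟 1 = IΓ`. [cite: StacksProject, Tag 0804]
[cite: BierstoneGrigorievMilmanWlodarczyk2011, §3.2] -/
theorem controlledTransform_eq_of_adapted {IΓ : G₁.IdealSheafData} {IZ : G.IdealSheafData} (hυ : IsBlowup υ IZ)
    (δ : IΓ.subscheme ⟶ IZ.subscheme) [IsIso δ] (hδ : δ ≫ IZ.subschemeι = IΓ.subschemeι ≫ υ)
    (hΓE : IΓ.support ≤ (IZ.comap υ).support)
    (𝒟 : G.IdealSheafData) (hI𝒟 : IZ * IZ ≤ 𝒟)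
    (hadapt : ∀ y' : ↥IΓ.subscheme, ∃ (c : Fin 2 → G.presheaf.stalk (υ (IΓ.subschemeι y')))
        (𝔔 : PrimeSpectrum (blowupAlgebra (Ideal.span (Set.range c)) (c 1)))
        (χ : blowupAlgebra (Ideal.span (Set.range c)) (c 1) →+* G₁.presheaf.stalk (IΓ.subschemeι y')),
      Ideal.span (Set.range c) = stalkIdeal IZ (υ (IΓ.subschemeι y')) ∧ IsQuasiRegular c ∧
      stalkIdeal 𝒟 (υ (IΓ.subschemeι y')) = Ideal.span {c 0} ⊔ Ideal.span {c 1 * c 1} ∧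
      (∀ a, χ (algebraMap _ _ a) = (υ.stalkMap (IΓ.subschemeι y')).hom a) ∧
      @IsLocalization.AtPrime _ _ (G₁.presheaf.stalk (IΓ.subschemeι y')) _ χ.toAlgebra 𝔔.asIdeal _ ∧
      𝔔.asIdeal.comap (algebraMap _ (blowupAlgebra (Ideal.span (Set.range c)) (c 1))) =
        maximalIdeal (G.presheaf.stalk (υ (IΓ.subschemeι y'))) ∧
      χ (blowupAlgebra.frac c 1 0) ∈ stalkIdeal IΓ (IΓ.subschemeι y')) :
    controlledTransform υ IZ 𝒟 1 = IΓ := by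
  refine ext_of_forall_stalkIdeal_eq fun y => ?_
  by_cases hyZ : υ y ∈ IZ.support
  swap
  · -- off `υ⁻¹V(IZ)`: both stalks are `⊤`
    have hyΓ : y ∉ IΓ.support := fun h => hyZ (by
      have h' := hΓE h
      rwa [Scheme.IdealSheafData.support_comap] at h')
    have hIZtop : stalkIdeal IZ (υ y) = ⊤ := stalkIdeal_eq_top_of_not_mem_support hyZ
    have h𝒟top : stalkIdeal 𝒟 (υ y) = ⊤ := by
      rw [eq_top_iff, ← Ideal.top_mul (⊤ : Ideal _), ← hIZtop, ← stalkIdeal_mul]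
      exact stalkIdeal_mono hI𝒟 _
    have hct : stalkIdeal (controlledTransform υ IZ 𝒟 1) y = ⊤ := by
      rw [eq_top_iff]
      refine le_trans ?_ (stalkIdeal_mono (comap_le_controlledTransform υ IZ 𝒟 1) y)
      rw [stalkIdeal_comap_eq_map_stalkMap, h𝒟top, Ideal.map_top]
    rw [hct, stalkIdeal_eq_top_of_not_mem_support hyΓ]
  by_cases hyΓ : y ∈ IΓ.support
  · -- at a point of the section
    obtain ⟨y', rfl⟩ := (mem_range_subschemeι_iff IΓ y).mpr hyΓ
    obtain ⟨c, 𝔔, χ, hc, hqr, h𝒟, hχ, hloc, h𝔔, hfrac⟩ := hadapt y'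
    have hP := stalkIdeal_eq_span_sup_span_of_adapted δ hδ y' c hc hqr 𝔔 χ hχ hloc h𝔔 hfrac
    have hχ' : ∀ a, χ (algebraMap _ _ a) =
        ((G.presheaf.stalkCongr (.of_eq rfl)).inv ≫ υ.stalkMap (IΓ.subschemeι y')).hom a := fun a => by
      rw [stalkCongr_refl_inv_stalkMap_apply]; exact hχ a
    obtain ⟨-, hct⟩ := stalkIdeal_directionCentre_of_chart_one hυ 𝒟 (IΓ.subschemeι y') rfl c hc h𝒟 χ hχ'
    rw [hct, hP, stalkCongr_refl_inv_stalkMap_apply]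
  · -- at a point of `υ⁻¹V(IZ)` off the section: over `υ y` sits a point `y₀ = ι y₀'` of the section
    obtain ⟨y₀', hy₀⟩ := exists_mem_support_of_section δ hδ hyZ
    obtain ⟨c, 𝔔₀, χ₀, hc, hqr, h𝒟, hχ₀, hloc₀, h𝔔₀, hfrac₀⟩ := hadapt y₀'
    have hx : υ y = υ (IΓ.subschemeι y₀') := hy₀.symm
    rw [stalkIdeal_eq_top_of_not_mem_support hyΓ]
    -- present `y` on a chart of the frame `c` (given at `υ y₀`)
    obtain ⟨i, 𝔔, χ, hχ, hloc, h𝔔⟩ := exists_chartPresentation_of_eq hυ y hx c hc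
    by_cases hi : i = 1
    · -- chart `m`: a point of the centre here would be `y₀`
      subst hi
      obtain ⟨-, hct⟩ := stalkIdeal_directionCentre_of_chart_one hυ 𝒟 y hx c hc h𝒟 χ hχ
      rw [hct]
      by_contra hne
      -- both generators lie in `𝔪_y`, so `𝔞 ≤ 𝔔`
      have hle : Ideal.span {((G.presheaf.stalkCongr (.of_eq hx)).inv ≫ υ.stalkMap y).hom (c 1)} ⊔
          Ideal.span {χ (blowupAlgebra.frac c 1 0)} ≤ maximalIdeal _ := IsLocalRing.le_maximalIdeal hne
      have hm : χ (algebraMap _ _ (c 1)) ∈ maximalIdeal _ := by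
        rw [hχ]; exact hle (Ideal.mem_sup_left (Ideal.mem_span_singleton_self _))
      have hf : χ (blowupAlgebra.frac c 1 0) ∈ maximalIdeal _ := hle (Ideal.mem_sup_right (Ideal.mem_span_singleton_self _))
      have h𝔞𝔔 := directionCentre_pair_le_chartPrime c 𝔔 χ hloc hm hf
      -- and `𝔞 ≤ 𝔔₀` (at the point `y₀` of the section)
      have hP₀max : stalkIdeal IΓ (IΓ.subschemeι y₀') ≤ maximalIdeal _ :=
        (mem_support_iff_stalkIdeal_le IΓ _).mp (subschemeι_apply_mem_support IΓ y₀')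
      obtain ⟨-, hkerP₀⟩ := surjective_and_ker_mk_comp_stalkMap_of_section δ hδ y₀'
      have hm₀ : (υ.stalkMap (IΓ.subschemeι y₀')).hom (c 1) ∈ stalkIdeal IΓ (IΓ.subschemeι y₀') := by
        have h : c 1 ∈ RingHom.ker ((Ideal.Quotient.mk (stalkIdeal IΓ (IΓ.subschemeι y₀'))).comp
            (υ.stalkMap (IΓ.subschemeι y₀')).hom) := by
          rw [hkerP₀, ← hc]; exact Ideal.subset_span (Set.mem_range_self 1)
        rwa [RingHom.mem_ker, RingHom.comp_apply, Ideal.Quotient.eq_zero_iff_mem] at h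
      have h𝔞𝔔₀ := directionCentre_pair_le_chartPrime c 𝔔₀ χ₀ hloc₀ (by rw [hχ₀]; exact hP₀max hm₀) (hP₀max hfrac₀)
      -- hence `𝔔 = 𝔔₀` and `y = y₀`
      have h𝔔eq : 𝔔 = 𝔔₀ := PrimeSpectrum.ext (eq_of_directionCentre_le_of_comap_eq c 1 h𝔞𝔔 h𝔞𝔔₀ (by rw [h𝔔, h𝔔₀]))
      subst h𝔔eq
      have hχ₀' : ∀ a, χ₀ (algebraMap _ _ a) =
          ((G.presheaf.stalkCongr (.of_eq rfl)).inv ≫ υ.stalkMap (IΓ.subschemeι y₀')).hom a := fun a => by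
        rw [stalkCongr_refl_inv_stalkMap_apply]; exact hχ₀ a
      have hyy₀ : y = IΓ.subschemeι y₀' := eq_of_chartPresentation_of_prime_eq hυ hx rfl c 1 𝔔 χ χ₀ hχ hχ₀' hloc hloc₀
      exact hyΓ (hyy₀ ▸ subschemeι_apply_mem_support IΓ y₀')
    · -- chart `ℓ`: the centre misses it
      have hi0 : i = 0 := by
        rcases Fin.exists_fin_two.mp ⟨i, rfl⟩ with h | h
        · exact h
        · exact absurd h hi
      subst hi0
      exact stalkIdeal_directionCentre_of_chart_zero hυ 𝒟 y hx c hc h𝒟 χ hχ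

/-- **DIRDICT (a′) — a direction ADAPTED to a section curve has the section as its centre** (reduced structures). `υ : G₁ → G` a blowing
up along `Ī = 𝓘⟨Z⟩`, `Γ ⊆ υ⁻¹Z` closed with an isomorphism `Γ̃ ⟶ Z̃` over `υ` (`DirStepSec` at the root), `𝒟` an ideal sheaf with
`Ī·Ī ≤ 𝒟` which at every `y ∈ Γ` admits a quasi-regular frame `c = (ℓ, m)` of `Ī_{υ y}` with `𝒟_{υ y} = (ℓ) + (m²)` and a chart-`m`
presentation `(𝔔, χ)` of `𝒪_{G₁,y}` with `χ(ℓ/m) ∈ 𝓘_{Γ,y}`. Then the weight-one controlled transform of `𝒟` (the direction centre of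
D1–D4) IS the ideal of the reduced section curve: `controlledTransform υ Ī 𝒟 1 = 𝓘⟨Γ⟩`. [cite: StacksProject, Tag 0804]
[cite: BierstoneGrigorievMilmanWlodarczyk2011, §3.2] -/
theorem controlledTransform_eq_vanishingIdeal_of_adapted (Z : Set G) (hZ : IsClosed Z)
    (hυ : IsBlowup υ (vanishingIdeal (⟨Z, hZ⟩ : Closeds G)))
    (Γ : Set G₁) (hΓ : IsClosed Γ) (hΓZ : Γ ⊆ υ ⁻¹' Z)
    (hsec : ∃ δ : (vanishingIdeal (⟨Γ, hΓ⟩ : Closeds G₁)).subscheme ⟶ (vanishingIdeal (⟨Z, hZ⟩ : Closeds G)).subscheme,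
      δ ≫ (vanishingIdeal (⟨Z, hZ⟩ : Closeds G)).subschemeι = (vanishingIdeal (⟨Γ, hΓ⟩ : Closeds G₁)).subschemeι ≫ υ ∧ IsIso δ)
    (𝒟 : G.IdealSheafData) (hI𝒟 : vanishingIdeal (⟨Z, hZ⟩ : Closeds G) * vanishingIdeal (⟨Z, hZ⟩ : Closeds G) ≤ 𝒟)
    (hadapt : ∀ y ∈ Γ, ∃ (c : Fin 2 → G.presheaf.stalk (υ y))
        (𝔔 : PrimeSpectrum (blowupAlgebra (Ideal.span (Set.range c)) (c 1)))
        (χ : blowupAlgebra (Ideal.span (Set.range c)) (c 1) →+* G₁.presheaf.stalk y),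
      Ideal.span (Set.range c) = stalkIdeal (vanishingIdeal (⟨Z, hZ⟩ : Closeds G)) (υ y) ∧ IsQuasiRegular c ∧
      stalkIdeal 𝒟 (υ y) = Ideal.span {c 0} ⊔ Ideal.span {c 1 * c 1} ∧
      (∀ a, χ (algebraMap _ _ a) = (υ.stalkMap y).hom a) ∧
      @IsLocalization.AtPrime _ _ (G₁.presheaf.stalk y) _ χ.toAlgebra 𝔔.asIdeal _ ∧
      𝔔.asIdeal.comap (algebraMap _ (blowupAlgebra (Ideal.span (Set.range c)) (c 1))) = maximalIdeal (G.presheaf.stalk (υ y)) ∧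
      χ (blowupAlgebra.frac c 1 0) ∈ stalkIdeal (vanishingIdeal (⟨Γ, hΓ⟩ : Closeds G₁)) y) :
    controlledTransform υ (vanishingIdeal (⟨Z, hZ⟩ : Closeds G)) 𝒟 1 = vanishingIdeal (⟨Γ, hΓ⟩ : Closeds G₁) := by
  obtain ⟨δ, hδ, hδiso⟩ := hsec
  haveI := hδiso
  have hΓE : (vanishingIdeal (⟨Γ, hΓ⟩ : Closeds G₁)).support ≤ ((vanishingIdeal (⟨Z, hZ⟩ : Closeds G)).comap υ).support := by
    intro y hy
    rw [Scheme.IdealSheafData.support_comap]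
    change υ y ∈ (vanishingIdeal (⟨Z, hZ⟩ : Closeds G)).support
    rw [mem_support_vanishingIdeal_iff]
    exact hΓZ ((mem_support_vanishingIdeal_iff Γ hΓ y).mp hy)
  refine controlledTransform_eq_of_adapted hυ δ hδ hΓE 𝒟 hI𝒟 fun y' => ?_
  exact hadapt _ ((mem_support_vanishingIdeal_iff Γ hΓ _).mp (subschemeι_apply_mem_support _ y'))

end Criterion

end Summit.ResolutionOfSingularities.ResolutionOfSingularities.Cruxes.EquisingularLiftNat.Sections

end
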